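import Mathlib
import HarnessLib
import Summits.Ventures.LatticeQCDFlow.Scaling.CumulantDiagonalLimit

/-!
# LatticeQCDFlow / Scaling — the partition function along EVERY coupling sequence with `β_n√n → c`:
# `n·cgf(β_n) → c²σ²/2`, `M(β_n)^n → e^{c²σ²/2}`, ESS fraction `→ e^{−c²σ²}`

HONEST FRAMING: exact (Metropolis-corrected) sampling algorithms for lattice gauge theory;
figures of merit are autocorrelation/cost numbers at stated couplings and volumes; no
continuum-physics claim.

Venture `LatticeQCDFlow` (cell pub-lqcd), topic `Scaling`; FANOUT row 3 (`s0-u1-a`, S0-B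
implementation A, GEN-19).  NEW WORK of the cell (sibling of row 3's `Scaling/CumulantDiagonalLimit`,
whose exact diagonal `β_n = c/√n` is the special case); NO definition is introduced; nothing is cited.

For a bounded centred statistic `X` (`σ² = Var X`) and every real sequence `β_n` with `β_n√n → c`:
* `exists_cgf_eq_iteratedDeriv_two_mul_of_ne` — two-sided Lagrange form `cgf(t) = cgf″(u)t²/2`,
  `|u| < |t|` (Mathlib's one-sided lemma reflected through `X ↦ −X`);
* **`tendsto_nat_mul_cgf_of_sqrt_mul_tendsto`** — `n·cgf(β_n) → c²σ²/2`;
* **`tendsto_mgf_pow_of_sqrt_mul_tendsto`** — `M(β_n)^n → e^{c²σ²/2}`;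
* `tendsto_essFrac_of_sqrt_mul_tendsto` — `(M(β_n)²/M(2β_n))^n → e^{−c²σ²}`.
This is the form the window statements of row 3 (`Scaling/IdentityFlowCouplingWindow`) use: the
log-normal parameter of the limit depends on the coupling sequence only through `lim β_n√n`.

NOT CLAIMED: unbounded statistics; rates; nothing re-scored.
-/

noncomputable section

namespace Summit.Ventures.LatticeQCDFlow.Theory2

open MeasureTheory ProbabilityTheory Filter Real Set
open scoped Topology

section GeneralDiagonal

variable {Ω : Type*} {mΩ : MeasurableSpace Ω} {μ : Measure Ω} [IsProbabilityMeasure μ] {X : Ω → ℝ}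

/-- **Two-sided Lagrange form at order two**: for a bounded centred statistic and every `t ≠ 0` there
is `u` with `|u| < |t|` and `cgf(t) = cgf″(u)·t²/2` (Mathlib's one-sided
`exists_cgf_eq_iteratedDeriv_two_cgf_mul`, reflected through `X ↦ −X` for `t < 0`). [ours] -/
theorem exists_cgf_eq_iteratedDeriv_two_mul_of_ne {a b : ℝ} (hm : AEMeasurable X μ)
    (hb : ∀ᵐ ω ∂μ, X ω ∈ Set.Icc a b) (hc : μ[X] = 0) {t : ℝ} (ht : t ≠ 0) :
    ∃ u : ℝ, |u| < |t| ∧ cgf X μ t = iteratedDeriv 2 (cgf X μ) u * t ^ 2 / 2 := by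
  rcases lt_or_gt_of_ne ht with hneg | hpos
  · -- `t < 0`: reflect
    have hm' : AEMeasurable (-X) μ := hm.neg
    have hb' : ∀ᵐ ω ∂μ, (-X) ω ∈ Set.Icc (-b) (-a) := by
      filter_upwards [hb] with ω hω
      simp only [Pi.neg_apply, Set.mem_Icc, neg_le_neg_iff]
      exact ⟨hω.2, hω.1⟩
    have hc' : μ[-X] = 0 := by simp only [Pi.neg_apply, integral_neg, hc, neg_zero]
    have hint' : interior (integrableExpSet (-X) μ) = Set.univ :=
      interior_integrableExpSet_eq_univ_of_mem_Icc hm' hb'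
    obtain ⟨u, hu, hequ⟩ := exists_cgf_eq_iteratedDeriv_two_cgf_mul (neg_pos.2 hneg) hc'
      (by rw [hint']; exact Set.subset_univ _)
    refine ⟨-u, ?_, ?_⟩
    · rw [abs_neg, abs_of_pos hu.1, abs_of_neg hneg]; exact hu.2
    · have hfun : cgf (-X) μ = fun s => cgf X μ (-s) := funext fun s => cgf_neg
      rw [hfun, iteratedDeriv_comp_neg] at hequ
      simp only [neg_neg, smul_eq_mul] at hequ
      rw [hequ]; ring
  · have hint : interior (integrableExpSet X μ) = Set.univ :=
      interior_integrableExpSet_eq_univ_of_mem_Icc hm hb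
    obtain ⟨u, hu, hequ⟩ := exists_cgf_eq_iteratedDeriv_two_cgf_mul hpos hc
      (by rw [hint]; exact Set.subset_univ _)
    exact ⟨u, by rw [abs_of_pos hu.1, abs_of_pos hpos]; exact hu.2, hequ⟩

/-- **`n·cgf(β_n) → c²σ²/2` ALONG EVERY COUPLING SEQUENCE WITH `β_n√n → c`** (bounded centred
statistic) — the diagonal of this file (`β_n = c/√n`) is the special case; this is the form the
window statements of row 3 use. [ours] -/
theorem tendsto_nat_mul_cgf_of_sqrt_mul_tendsto {a b : ℝ} (hm : AEMeasurable X μ)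
    (hb : ∀ᵐ ω ∂μ, X ω ∈ Set.Icc a b) (hc : μ[X] = 0) {β : ℕ → ℝ} {c : ℝ}
    (hβ : Tendsto (fun n : ℕ => β n * Real.sqrt n) atTop (𝓝 c)) :
    Tendsto (fun n : ℕ => (n : ℝ) * cgf X μ (β n)) atTop (𝓝 (c ^ 2 * Var[X; μ] / 2)) := by
  classical
  -- intermediate points `u n`, `|u n| ≤ |β n|`
  have hE : ∀ n : ℕ, β n ≠ 0 → ∃ u : ℝ, |u| < |β n| ∧
      cgf X μ (β n) = iteratedDeriv 2 (cgf X μ) u * β n ^ 2 / 2 := fun n hn =>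
    exists_cgf_eq_iteratedDeriv_two_mul_of_ne hm hb hc hn
  let u : ℕ → ℝ := fun n => if hn : β n ≠ 0 then (hE n hn).choose else 0
  have hu_abs : ∀ n, |u n| ≤ |β n| := fun n => by
    by_cases hn : β n ≠ 0
    · simp only [u, hn, ↓reduceDIte, ne_eq, not_false_eq_true]; exact (hE n hn).choose_spec.1.le
    · simp only [u, hn, ↓reduceDIte]; simp
  have hu_eq : ∀ n : ℕ, (n : ℝ) * cgf X μ (β n)
      = iteratedDeriv 2 (cgf X μ) (u n) / 2 * (β n * Real.sqrt n) ^ 2 := fun n => by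
    by_cases hn : β n ≠ 0
    · have hw := (hE n hn).choose_spec.2
      simp only [u, hn, ↓reduceDIte, ne_eq, not_false_eq_true]
      generalize (hE n hn).choose = w at hw ⊢
      rw [hw, mul_pow, Real.sq_sqrt (Nat.cast_nonneg n)]
      ring
    · push Not at hn
      simp [hn, cgf_zero]
  -- `β n → 0`, hence `u n → 0`
  have hβ0 : Tendsto β atTop (𝓝 0) := by
    have h1 : Tendsto (fun n : ℕ => (β n * Real.sqrt n) * (Real.sqrt n)⁻¹) atTop (𝓝 (c * 0)) :=
      hβ.mul (tendsto_inv_atTop_zero.comp (Real.tendsto_sqrt_atTop.comp tendsto_natCast_atTop_atTop))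
    rw [mul_zero] at h1
    refine h1.congr' ?_
    filter_upwards [eventually_gt_atTop 0] with n hn
    have hsn : Real.sqrt n ≠ 0 := (Real.sqrt_pos.2 (Nat.cast_pos.2 hn)).ne'
    field_simp
  have hu0 : Tendsto u atTop (𝓝 0) := by
    rw [tendsto_zero_iff_norm_tendsto_zero]
    have hβabs : Tendsto (fun n => |β n|) atTop (𝓝 0) := by simpa using hβ0.abs
    exact squeeze_zero (fun n => norm_nonneg _) (fun n => by simpa [Real.norm_eq_abs] using hu_abs n) hβabs
  have hcont := (continuous_iteratedDeriv_two_cgf_of_mem_Icc hm hb).continuousAt (x := (0 : ℝ))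
  have hlim : Tendsto (fun n => iteratedDeriv 2 (cgf X μ) (u n)) atTop (𝓝 (Var[X; μ])) := by
    rw [← iteratedDeriv_two_cgf_zero_of_mem_Icc hm hb]
    exact hcont.tendsto.comp hu0
  have key := (hlim.div_const 2).mul (hβ.pow 2)
  rw [show Var[X; μ] / 2 * c ^ 2 = c ^ 2 * Var[X; μ] / 2 by ring] at key
  exact key.congr fun n => (hu_eq n).symm

/-- **THE PARTITION FUNCTION ALONG EVERY COUPLING SEQUENCE**: `β_n√n → c` ⇒ `M(β_n)^n → e^{c²σ²/2}`.
[ours] -/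
theorem tendsto_mgf_pow_of_sqrt_mul_tendsto {a b : ℝ} (hm : AEMeasurable X μ)
    (hb : ∀ᵐ ω ∂μ, X ω ∈ Set.Icc a b) (hc : μ[X] = 0) {β : ℕ → ℝ} {c : ℝ}
    (hβ : Tendsto (fun n : ℕ => β n * Real.sqrt n) atTop (𝓝 c)) :
    Tendsto (fun n : ℕ => mgf X μ (β n) ^ n) atTop (𝓝 (Real.exp (c ^ 2 * Var[X; μ] / 2))) := by
  have hi : ∀ u : ℝ, Integrable (fun ω => Real.exp (u * X ω)) μ := fun u =>
    integrable_exp_mul_of_mem_Icc hm hb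
  have h := (Real.continuous_exp.tendsto _).comp (tendsto_nat_mul_cgf_of_sqrt_mul_tendsto hm hb hc hβ)
  refine h.congr fun n => ?_
  simp only [Function.comp_apply]
  rw [← exp_cgf (hi _), ← Real.exp_nat_mul]

/-- **THE ESS FRACTION ALONG EVERY COUPLING SEQUENCE**: `β_n√n → c` ⇒
`(M(β_n)²/M(2β_n))^n → e^{−c²σ²}`. [ours] -/
theorem tendsto_essFrac_of_sqrt_mul_tendsto {a b : ℝ} (hm : AEMeasurable X μ)
    (hb : ∀ᵐ ω ∂μ, X ω ∈ Set.Icc a b) (hc : μ[X] = 0) {β : ℕ → ℝ} {c : ℝ}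
    (hβ : Tendsto (fun n : ℕ => β n * Real.sqrt n) atTop (𝓝 c)) :
    Tendsto (fun n : ℕ => (mgf X μ (β n) ^ 2 / mgf X μ (2 * β n)) ^ n) atTop
      (𝓝 (Real.exp (-(c ^ 2 * Var[X; μ])))) := by
  have h1 := tendsto_mgf_pow_of_sqrt_mul_tendsto hm hb hc hβ
  have hβ2 : Tendsto (fun n : ℕ => 2 * β n * Real.sqrt n) atTop (𝓝 (2 * c)) := by
    have := hβ.const_mul 2; refine this.congr fun n => ?_; ring
  have h2 := tendsto_mgf_pow_of_sqrt_mul_tendsto hm hb hc hβ2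
  have hne : Real.exp ((2 * c) ^ 2 * Var[X; μ] / 2) ≠ 0 := (Real.exp_pos _).ne'
  have key := (h1.pow 2).div h2 hne
  have e : Real.exp (c ^ 2 * Var[X; μ] / 2) ^ 2 / Real.exp ((2 * c) ^ 2 * Var[X; μ] / 2)
      = Real.exp (-(c ^ 2 * Var[X; μ])) := by
    rw [← Real.exp_nat_mul, ← Real.exp_sub]; congr 1; push_cast; ring
  rw [e] at key
  refine key.congr fun n => ?_
  simp only [Pi.div_apply]
  rw [div_pow, ← pow_mul, ← pow_mul, mul_comm n 2]

end GeneralDiagonal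

end Summit.Ventures.LatticeQCDFlow.Theory2

end
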